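import Summits.BirchSwinnertonDyer.BirchSwinnertonDyer.Theses.TangentCone
import Summits.BirchSwinnertonDyer.BirchSwinnertonDyer.Theses.PAdicOrderV2
import Summits.BirchSwinnertonDyer.BirchSwinnertonDyer.Theorems.PAdicOrderV2PAdicOrderThesisR2StubUBPosEnvelope
import Literature.NumberTheory.EllipticCurves.KatoRankBound
import Literature.NumberTheory.EllipticCurves.PAdicGrossZagier
import Literature.NumberTheory.EllipticCurves.PAdicGrossZagierProofs
import Literature.NumberTheory.EllipticCurves.PAdicLFunctionK
import Literature.NumberTheory.EllipticCurves.PAdicBSD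
import Literature.NumberTheory.EllipticCurves.BSDSelmerPConverseRankOneRubinProofs
import Literature.NumberTheory.EllipticCurves.RootNumberEvenAnalyticRankProofs
import Literature.Barriers.BirchSwinnertonDyer.HeegnerPointsRankOneProofs
import HarnessLib

/-!
# BirchSwinnertonDyer / TangentCone — crux `SelmerRankCM` (stmt-BirchSwinnertonDyer-18086), line
# `rubin-squeeze`, stub `stub_analyticRankLeOrderCM`: the cell `r_an = 3` from printed theorems

Support file (helper, `--supports`; it does NOT close the stub). The registered stub
`stub_analyticRankLeOrderCM` of `Cruxes/SelmerRankCM/Lines/rubin_squeeze.lean` asks, for a CM curve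
`E/ℚ` (globally minimal `W`), a good ordinary prime `p ≥ 5`, `3 ≤ r_an(E) = ord_{s=1} L(E,s)` and
any newform `f` of `E`, for `r_an ≤ ord_{T=0} L_p(f, α_p, T)` — the CM column of clause LB3 of
the OPEN crux `PAdicOrderV2.PAdicOrderComparisonR2` (stmt-BirchSwinnertonDyer-0489;
`Theorems.pAdicOrderComparisonR2_iff_open_inequalities`). From `r_an = 4` on no mechanism turning
`L''(E,1) = 0` into `[T²] L_p = 0` is known, so the `∀`-statement is not landed here.

What IS in print is the cell `r_an = 3` (indeed: `r_an` odd and `≥ 3 ⟹ 3 ≤ ord_T L_p`, for EVERY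
`E/ℚ`, CM or not), by the classical auxiliary-field argument (Perrin-Riou 1987, §1.4; Greenberg,
LNM 1716, §4 p. 111 and §5 p. 181):

1. `w(E) = (-1)^{r_an} = -1` (`rootNumber_eq_neg_one_pow_analyticRank_of_exists_isNewformOf`,
   modularity `exists_isNewformOf`), so Hoffstein–Luo (`HoffsteinLuo1997_exists_twist_L_one_ne_zero`,
   through `exists_heegnerField_odd_split_twist_ne_zero_of_hoffsteinLuo`) supply an imaginary
   quadratic `K` with odd `d_K`, every `ℓ ∣ N_E` split, `p` split and `L(E^{(d_K)}, 1) ≠ 0`;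
2. a Heegner point `P_K ∈ E(K)` (`exists_isHeegnerPoint`) is TORSION because `r_an ≥ 2` forces
   `L'(E/K, 1) = 0` and Gross–Zagier (`gross_zagier`) reads `L'(E/K,1) = c·ĥ(P_K)`, `c > 0`
   (`isOfFinAddOrder_of_isHeegnerPoint_of_two_le_analyticRank`), hence its canonical cyclotomic
   `p`-adic height vanishes (`PAdicHeightDataK.map_torsion`; THE canonical `K`-height exists,
   `exists_isCanonicalK_of_ncard_primesOver_eq_two`, a tree theorem);
3. Perrin-Riou's `p`-adic Gross–Zagier formula (`perrinRiou_padicGrossZagier`, Thm. 1.3) then says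
   `ord_{T=0} L_p(E/K, T) ≠ 1`, and `≥ 1`, so `≥ 2`; and `L_p(E/K, T) = L_p(f, α, T)·L_p(g, α, T)`
   (`padicLFunctionEK_of_split`) with `L_p(g, α, 0) ≠ 0` (`constantCoeff_padicLFunction_twist`,
   `L(E^{(d_K)}, 1) ≠ 0`), so `ord_{T=0} L_p(f, α, T) ≥ 2`;
4. the `p`-adic and complex functional equations have the same sign (tree THEOREM
   `stub_even_order_iff_even_analyticRank`, packaged as `exists_order_padicLFunction_eq_natCast`),
   so the order is odd: `≥ 3`.

Every deep input is an EXISTING named fact of the tree entering as a hypothesis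
(`perrinRiou_padicGrossZagier`, `gross_zagier`, `exists_isHeegnerPoint`, `exists_isNewformOf`,
`HoffsteinLuo1997_exists_twist_L_one_ne_zero`); nothing is asserted, no definition, no new fact.

* `two_le_order_padicLFunction_of_heegnerField` — steps 2–3 with the field `K` as data;
* `three_le_order_padicLFunction_of_heegnerField` — plus step 4 (`r_an` odd);
* `three_le_order_padicLFunction_of_facts` — the field from Hoffstein–Luo (step 1);
* `analyticRankLeOrderCM_three_of_facts` — the stub's shape with `W.analyticRank = 3`, in the
  registered colon form `facts → …` (sub-goal stub of the crux item, landed with `--supports`);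
* `analyticRankLeOrder_of_facts_of_four_le` — the stub's `∀`-statement (CM-free) reduces to its
  cells `4 ≤ r_an`, which are open.
-/

-- single-conjunct summit: `Summit.BirchSwinnertonDyer.BirchSwinnertonDyer.…` repeats the name by design
set_option linter.dupNamespace false

namespace Summit.BirchSwinnertonDyer.BirchSwinnertonDyer.Theorems

open scoped Classical MatrixGroups ModularForm
open CongruenceSubgroup NumberField
open Literature.NumberTheory.EllipticCurves
open Literature.NumberTheory.EllipticCurves.ModularForms (IsNewformOf exists_isNewformOf)
open Summit.BirchSwinnertonDyer.BirchSwinnertonDyer.Cruxes.PAdicOrderThesisR2.KatoSandwich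
  (exists_order_padicLFunction_eq_natCast)

/-- **`r_an(E) ≥ 2 ⟹ ord_{T=0} L_p(E, T) ≥ 2` given an auxiliary Heegner field**, relative to
Perrin-Riou's `p`-adic Gross–Zagier formula (`hPR`, Perrin-Riou 1987, Thm. 1.3), Gross–Zagier
(`hGZ`, with the `K`-rationality of Heegner points `hHeeg`) and modularity (`hmod`, for the newform
of the twist). Data: `E/ℚ` (globally minimal `W`), `p ≥ 5` good ordinary, `K` imaginary quadratic
with odd `d_K`, every `ℓ ∣ N_E` split, `p` split, `L(E^{(d_K)}, 1) ≠ 0`, and a newform `f` of `E`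
(any level). If `ord_{s=1} L(E, s) ≥ 2` then the Heegner point is torsion (Gross–Zagier:
`L'(E/K,1) = 0`), its canonical cyclotomic `p`-adic height is `0`, so `L_p(E/K, T)` does NOT have a
simple zero (Perrin-Riou) while it vanishes at `0`; as `L_p(E/K) = L_p(f,α)·L_p(g,α)` with
`L_p(g,α,0) ≠ 0`, `ord_{T=0} L_p(f, α, T) ≥ 2`. Greenberg, LNM 1716, §4 p. 111 (read for a torsion
Heegner point). [cite: PerrinRiou1987, Thm. 1.3 and §1.4] [cite: GreenbergLNM1716, §4 (p. 111)] -/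
theorem two_le_order_padicLFunction_of_heegnerField (hPR : perrinRiou_padicGrossZagier)
    (hGZ : ∀ (N : ℕ) [NeZero N] (W : WeierstrassCurve ℚ) (K : Type) [Field K] [NumberField K],
      gross_zagier N W K)
    (hHeeg : ∀ (W : WeierstrassCurve ℚ) (K : Type) [Field K] [NumberField K],
      exists_isHeegnerPoint W K)
    (hmod : exists_isNewformOf)
    (W : WeierstrassCurve ℚ) [W.IsElliptic] [W.IsGloballyMinimal] (p : ℕ) [Fact p.Prime]
    (hp : 5 ≤ p) (hgood : W.HasGoodReductionAtPrime p) (hord : ¬ (p : ℤ) ∣ W.frobeniusTrace p)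
    (K : Type) [Field K] [NumberField K] (hK : IsImaginaryQuadratic K)
    (hodd : Odd (NumberField.discr K)) (hH : SatisfiesHeegnerHypothesis (W.conductorNorm ℤ) K)
    (hsplit : ((Ideal.span {(p : ℤ)}).primesOver (𝓞 K)).ncard = 2)
    (hL1 : (W.quadraticTwist (NumberField.discr K : ℚ)).entireLFunction 1 ≠ 0)
    {N : ℕ} [NeZero N] {f : CuspForm (Gamma0 N) 2} (hf : IsNewformOf W f)
    (h2 : 2 ≤ W.analyticRank) :
    (2 : ℕ∞) ≤ (padicLFunction f (unitRoot W p : ℚ_[p])).order := by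
  have hpP : p.Prime := Fact.out
  haveI : NeZero (W.conductorNorm ℤ) := ⟨(W.conductorNorm_pos_holds).ne'⟩
  have hordW : IsOrdinaryAt W p := ⟨hgood, hord⟩
  -- `(d_K, N_E) = 1`, a Heegner point, the newform of the twist, the canonical height over `K`
  have hcop : IsCoprime (NumberField.discr K) (W.conductorNorm ℤ : ℤ) := by
    rw [Int.isCoprime_iff_gcd_eq_one, Int.gcd_comm]
    exact Literature.SatisfiesHeegnerHypothesis.coprime_discr hK.1 hH
  obtain ⟨P, hP⟩ := hHeeg W K hK hH
  have hdK : (NumberField.discr K : ℚ) ≠ 0 := by exact_mod_cast NumberField.discr_ne_zero K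
  haveI := W.isElliptic_quadraticTwist hdK
  haveI : NeZero ((W.quadraticTwist (NumberField.discr K : ℚ)).conductorNorm ℤ) :=
    ⟨((W.quadraticTwist (NumberField.discr K : ℚ)).conductorNorm_pos_holds).ne'⟩
  obtain ⟨g, hg⟩ := hmod (W.quadraticTwist (NumberField.discr K : ℚ))
  obtain ⟨DK, hDK⟩ :=
    exists_isCanonicalK_of_ncard_primesOver_eq_two W K hK.1 p hp hgood hord hsplit
  -- the twist factor has order `0` (`L(E^{(d_K)}, 1) ≠ 0`)
  have hg0 : PowerSeries.constantCoeff (padicLFunction g (unitRoot W p : ℚ_[p])) ≠ 0 := by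
    obtain ⟨hsq, hne⟩ := isSquare_discr_of_ncard_primesOver_eq_two hK.1 hpP hsplit
    rw [constantCoeff_padicLFunction_twist (NumberField.discr_ne_zero K) (by omega)
      ((legendreSym.eq_one_iff p hne).mpr hsq) hordW hg]
    refine mul_ne_zero (pow_ne_zero _ (one_sub_unitRoot_inv_ne_zero W p hordW)) fun h0 ↦ hL1 ?_
    have h0' : (ratPlusSymbol g 0 : ℚ) = 0 := by exact_mod_cast h0
    rw [hg.entireLFunction_one_eq, h0']
    simp
  have hordg : (padicLFunction g (unitRoot W p : ℚ_[p])).order = 0 := by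
    have h0 : ((0 : ℕ) : ℕ∞) = 0 := Nat.cast_zero
    rw [← h0, PowerSeries.order_eq_nat]
    exact ⟨by rwa [PowerSeries.coeff_zero_eq_constantCoeff_apply],
      fun i hi ↦ absurd hi (Nat.not_lt_zero i)⟩
  -- so `ord L_p(E/K, T) = ord L_p(f, α, T)`
  have hEK : (padicLFunctionEK W p K hf hg).order =
      (padicLFunction f (unitRoot W p : ℚ_[p])).order := by
    rw [padicLFunctionEK_of_split W p K hf hg hsplit, PowerSeries.order_mul, hordg, add_zero]
  -- Gross–Zagier: the Heegner point is torsion, so its canonical `p`-adic height vanishes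
  have htor : IsOfFinAddOrder P :=
    Literature.Barriers.BirchSwinnertonDyer.isOfFinAddOrder_of_isHeegnerPoint_of_two_le_analyticRank
      W (W.conductorNorm ℤ) K (hGZ _ W K) hK hH h2 hP
  have hh : DK.height P = 0 := DK.map_torsion P P htor
  -- Perrin-Riou: `ord L_p(E/K, T) ≥ 1` and `≠ 1`
  have h1le : (1 : ℕ∞) ≤ (padicLFunctionEK W p K hf hg).order :=
    hPR.one_le_order hf hg hp hgood hord hK hodd hcop rfl hH hsplit hDK hP
  have hne1 : (padicLFunctionEK W p K hf hg).order ≠ 1 := fun h1 ↦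
    ((hPR.order_eq_one_iff hf hg hp hgood hord hK hodd hcop rfl hH hsplit hDK hP).mp h1) hh
  rw [← hEK]
  have hlt : (1 : ℕ∞) < (padicLFunctionEK W p K hf hg).order := lt_of_le_of_ne h1le hne1.symm
  have h11 : (1 : ℕ∞) + 1 ≤ (padicLFunctionEK W p K hf hg).order := Order.add_one_le_of_lt hlt
  rwa [one_add_one_eq_two] at h11

/-- **`r_an(E)` odd and `≥ 3 ⟹ ord_{T=0} L_p(E, T) ≥ 3` given an auxiliary Heegner field** (the
cell `r_an = 3` of "the `p`-adic order dominates the complex order"): `ord ≥ 2` by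
`two_le_order_padicLFunction_of_heegnerField` (Perrin-Riou + Gross–Zagier with a torsion Heegner
point), and the order is a natural number with the parity of `r_an`
(`exists_order_padicLFunction_eq_natCast`: the signs of the `p`-adic and complex functional
equations agree, Greenberg, LNM 1716, §5 p. 181; Mazur–Tate–Teitelbaum 1986, §I.17), hence odd,
hence `≥ 3`. [cite: PerrinRiou1987, Thm. 1.3 and §1.4] [cite: GreenbergLNM1716, §5 (p. 181)] -/
theorem three_le_order_padicLFunction_of_heegnerField (hPR : perrinRiou_padicGrossZagier)
    (hGZ : ∀ (N : ℕ) [NeZero N] (W : WeierstrassCurve ℚ) (K : Type) [Field K] [NumberField K],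
      gross_zagier N W K)
    (hHeeg : ∀ (W : WeierstrassCurve ℚ) (K : Type) [Field K] [NumberField K],
      exists_isHeegnerPoint W K)
    (hmod : exists_isNewformOf)
    (W : WeierstrassCurve ℚ) [W.IsElliptic] [W.IsGloballyMinimal] (p : ℕ) [Fact p.Prime]
    (hp : 5 ≤ p) (hgood : W.HasGoodReductionAtPrime p) (hord : ¬ (p : ℤ) ∣ W.frobeniusTrace p)
    (K : Type) [Field K] [NumberField K] (hK : IsImaginaryQuadratic K)
    (hodd : Odd (NumberField.discr K)) (hH : SatisfiesHeegnerHypothesis (W.conductorNorm ℤ) K)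
    (hsplit : ((Ideal.span {(p : ℤ)}).primesOver (𝓞 K)).ncard = 2)
    (hL1 : (W.quadraticTwist (NumberField.discr K : ℚ)).entireLFunction 1 ≠ 0)
    {N : ℕ} [NeZero N] {f : CuspForm (Gamma0 N) 2} (hf : IsNewformOf W f)
    (hro : Odd W.analyticRank) (h3 : 3 ≤ W.analyticRank) :
    (3 : ℕ∞) ≤ (padicLFunction f (unitRoot W p : ℚ_[p])).order := by
  have hordW : IsOrdinaryAt W p := ⟨hgood, hord⟩
  have h2 := two_le_order_padicLFunction_of_heegnerField hPR hGZ hHeeg hmod W p hp hgood hord K hK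
    hodd hH hsplit hL1 hf (by omega)
  obtain ⟨n, hn, hpar, -⟩ := exists_order_padicLFunction_eq_natCast W p hordW hf
  rw [hn] at h2 ⊢
  have h2' : 2 ≤ n := by exact_mod_cast h2
  have hn_odd : Odd n := by
    rcases Nat.even_or_odd n with he | ho
    · exact absurd (hpar.mp he) (Nat.not_even_iff_odd.mpr hro)
    · exact ho
  have h3' : 3 ≤ n := by
    obtain ⟨k, hk⟩ := hn_odd
    omega
  exact_mod_cast h3'

/-- **`r_an(E)` odd and `≥ 3 ⟹ ord_{T=0} L_p(E, T) ≥ 3` at every good ordinary `p ≥ 5`, for every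
`E/ℚ`**, below Perrin-Riou (`hPR`), Gross–Zagier (`hGZ`, `hHeeg`), modularity (`hmod`) and
Hoffstein–Luo (`hHL`): the sign is `w(E) = (-1)^{r_an} = -1`
(`rootNumber_eq_neg_one_pow_analyticRank_of_exists_isNewformOf`), so Hoffstein–Luo's theorem
(squarefree `d ≡ 1 (mod 8)` with `(d/q) = 1` at the odd `q ∣ N_E p` and `L(E^{(d)}, 1) ≠ 0`;
`exists_heegnerField_odd_split_twist_ne_zero_of_hoffsteinLuo`) supplies the auxiliary field of
`three_le_order_padicLFunction_of_heegnerField`. In particular the cell `r_an = 3` of clause LB3 of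
crux `PAdicOrderComparisonR2` is literature. [cite: PerrinRiou1987, Thm. 1.3 and §1.4]
[cite: HoffsteinLuo1997, Theorem (§1, pp. 435–436)] [cite: GreenbergLNM1716, §5 (p. 181)] -/
theorem three_le_order_padicLFunction_of_facts (hPR : perrinRiou_padicGrossZagier)
    (hGZ : ∀ (N : ℕ) [NeZero N] (W : WeierstrassCurve ℚ) (K : Type) [Field K] [NumberField K],
      gross_zagier N W K)
    (hHeeg : ∀ (W : WeierstrassCurve ℚ) (K : Type) [Field K] [NumberField K],
      exists_isHeegnerPoint W K)
    (hmod : exists_isNewformOf) (hHL : HoffsteinLuo1997_exists_twist_L_one_ne_zero) :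
    ∀ (W : WeierstrassCurve ℚ) [W.IsElliptic] [W.IsGloballyMinimal] (p : ℕ) [Fact p.Prime],
      5 ≤ p → W.HasGoodReductionAtPrime p → ¬ (p : ℤ) ∣ W.frobeniusTrace p →
      Odd W.analyticRank → 3 ≤ W.analyticRank →
      ∀ {N : ℕ} [NeZero N] (f : CuspForm (Gamma0 N) 2), IsNewformOf W f →
        (3 : ℕ∞) ≤ (padicLFunction f (unitRoot W p : ℚ_[p])).order := by
  intro W _ _ p _ hp hgood hord hro h3 N _ f hf
  have hw : W.rootNumber = -1 := by
    rw [W.rootNumber_eq_neg_one_pow_analyticRank_of_exists_isNewformOf hmod, hro.neg_one_pow]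
  obtain ⟨K, _, _, hK, hoddK, hH, hsplit, hL1⟩ :=
    exists_heegnerField_odd_split_twist_ne_zero_of_hoffsteinLuo hmod hHL W hw p
  exact three_le_order_padicLFunction_of_heegnerField hPR hGZ hHeeg hmod W p hp hgood hord K hK
    hoddK hH hsplit hL1 hf hro h3

/-- **The cell `r_an = 3` of stub `stub_analyticRankLeOrderCM`** (line `rubin-squeeze`, crux
`SelmerRankCM`, stmt-BirchSwinnertonDyer-18086), in the stub's registered shape with
`3 ≤ W.analyticRank` replaced by `W.analyticRank = 3`: for a CM curve (the CM hypothesis is not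
used) at a good ordinary `p ≥ 5` and any newform `f` of `E`, `r_an ≤ ord_{T=0} L_p(f, α_p, T)`,
below the named facts of `three_le_order_padicLFunction_of_facts` (registered colon form
`facts → (stub with r_an = 3)`, a sub-goal stub of the crux item; it SUPPORTS
stmt-BirchSwinnertonDyer-18086 and does not close it).
[cite: PerrinRiou1987, Thm. 1.3 and §1.4] [cite: GreenbergLNM1716, §5 (p. 181)] -/
theorem analyticRankLeOrderCM_three_of_facts : perrinRiou_padicGrossZagier → (∀ (N : ℕ) [NeZero N] (W : WeierstrassCurve ℚ) (K : Type) [Field K] [NumberField K], gross_zagier N W K) → (∀ (W : WeierstrassCurve ℚ) (K : Type) [Field K] [NumberField K], exists_isHeegnerPoint W K) → exists_isNewformOf → HoffsteinLuo1997_exists_twist_L_one_ne_zero → ∀ (W : WeierstrassCurve ℚ) [W.IsElliptic] [W.IsGloballyMinimal] (p : ℕ) [Fact p.Prime], 5 ≤ p → W.HasGoodReductionAtPrime p → ¬ (p : ℤ) ∣ W.frobeniusTrace p → W.HasCM → W.analyticRank = 3 → ∀ {N : ℕ} [NeZero N] (f : CuspForm (CongruenceSubgroup.Gamma0 N) 2),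 IsNewformOf W f → (W.analyticRank : ℕ∞) ≤ (padicLFunction f (unitRoot W p : ℚ_[p])).order := by
  intro hPR hGZ hHeeg hmod hHL W _ _ p _ hp hgood hord _ h3 N _ f hf
  have hro : Odd W.analyticRank := by rw [h3]; decide
  have h := three_le_order_padicLFunction_of_facts hPR hGZ hHeeg hmod hHL W p hp hgood hord hro
    (by omega) f hf
  rw [h3]
  exact_mod_cast h

/-- **What is left of the stub: the cells `4 ≤ r_an`.** Below the same named facts, the
`∀`-statement "`3 ≤ r_an ⟹ r_an ≤ ord_{T=0} L_p`" at good ordinary `p ≥ 5` (clause LB3 of crux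
`PAdicOrderComparisonR2`, here CM-free) follows from its restriction to `4 ≤ r_an` — which is OPEN
(no mechanism turns `L''(E, 1) = 0` into `[T²] L_p(E, T) = 0`; Mazur–Tate–Teitelbaum 1986, §II.10).
[cite: MazurTateTeitelbaum1986Invent, §II.10] [cite: PerrinRiou1987, Thm. 1.3 and §1.4] -/
theorem analyticRankLeOrder_of_facts_of_four_le (hPR : perrinRiou_padicGrossZagier)
    (hGZ : ∀ (N : ℕ) [NeZero N] (W : WeierstrassCurve ℚ) (K : Type) [Field K] [NumberField K],
      gross_zagier N W K)
    (hHeeg : ∀ (W : WeierstrassCurve ℚ) (K : Type) [Field K] [NumberField K],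
      exists_isHeegnerPoint W K)
    (hmod : exists_isNewformOf) (hHL : HoffsteinLuo1997_exists_twist_L_one_ne_zero)
    (h4 : ∀ (W : WeierstrassCurve ℚ) [W.IsElliptic] [W.IsGloballyMinimal] (p : ℕ) [Fact p.Prime],
      5 ≤ p → W.HasGoodReductionAtPrime p → ¬ (p : ℤ) ∣ W.frobeniusTrace p →
      4 ≤ W.analyticRank →
      ∀ {N : ℕ} [NeZero N] (f : CuspForm (CongruenceSubgroup.Gamma0 N) 2), IsNewformOf W f →
        (W.analyticRank : ℕ∞) ≤ (padicLFunction f (unitRoot W p : ℚ_[p])).order) :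
    ∀ (W : WeierstrassCurve ℚ) [W.IsElliptic] [W.IsGloballyMinimal] (p : ℕ) [Fact p.Prime],
      5 ≤ p → W.HasGoodReductionAtPrime p → ¬ (p : ℤ) ∣ W.frobeniusTrace p →
      3 ≤ W.analyticRank →
      ∀ {N : ℕ} [NeZero N] (f : CuspForm (CongruenceSubgroup.Gamma0 N) 2), IsNewformOf W f →
        (W.analyticRank : ℕ∞) ≤ (padicLFunction f (unitRoot W p : ℚ_[p])).order := by
  intro W _ _ p _ hp hgood hord h3 N _ f hf
  rcases Nat.lt_or_ge W.analyticRank 4 with hlt | hge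
  · have h3e : W.analyticRank = 3 := by omega
    have hro : Odd W.analyticRank := by rw [h3e]; decide
    have h := three_le_order_padicLFunction_of_facts hPR hGZ hHeeg hmod hHL W p hp hgood hord hro
      h3 f hf
    rw [h3e]
    exact_mod_cast h
  · exact h4 W p hp hgood hord hge f hf

end Summit.BirchSwinnertonDyer.BirchSwinnertonDyer.Theorems
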